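import Literature.MathematicalPhysics.QuantumFieldTheory.Balaban1983to89.HaarExpChartChangeOfVariablesPiMeasure
import Literature.MathematicalPhysics.QuantumFieldTheory.Balaban1983to89.HaarDensitySpecialUnitaryGlobal
import Literature.MathematicalPhysics.QuantumFieldTheory.Balaban1983to89.UnitaryModel

/-!
# `Balaban1983to89.FieldMeasureExpChartChangeOfVariables` — the change of variables for the PRODUCT HAAR MEASURE OF THE BOND
# VARIABLES `dU = Π_b dU(b)` (`fieldMeasure P j SU(N)`, [Balaban1985Averaging] (10) p. 19) under maps that are `C¹` in the
# bond-wise exponential chart of `SU(N)`: files 1–3 (`HaarExpChartChangeOfVariables{,Pi,PiMeasure}`) READ AT THE CELL'S TYPES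
# (`Matrix.specialUnitaryGroup (Fin N) ℂ`, `HaarData.haar`, `GaugeField P j`, `fieldMeasure P j`), plus the right-translated windows

statement-level skeleton of published theorems with citation tags; proofs where landed; nothing here is a claim
about the Yang–Mills mass gap

Cell `pub-ymgap`, seat `pub-ymgap-dag-n09-w4` (gen 4; node N09, helper lane of the K1⁷ item, count-neutral).  File 4 of the
(F1) group-chart composition: the consumer-facing reading.  The Jacobian face of [Balaban1987RG1] (2.10) p. 267 («∫dV δ(V̄W⁻¹)… =
∫dB′ σ(B′)…», then «B′ = B − hD̃(B)») is a change of variables for `dU = Π_b dU(b)` supported in a window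
`Θ^B(S) · U₀` around a configuration `U₀`; here `Θ = exp` on `𝔰𝔲(N)` is p28's `isChartRep_specialUnitaryGroup`, `|det jac|` its
`jacDensity (lie_adStable_specialUnitaryGroup)`, `σ₀ = μ(V_s)/ν_s(V_s)` its window constant, `HaarData.haar` = Mathlib's `haarMeasure ⊤`
(`UnitaryModel`, so `IsHaarMeasure` holds: `isHaarMeasure_haar_specialUnitaryGroup`), and `fieldMeasure P j G = ⊗_{b ∈ PBond P j} HaarData.haar` (`rfl`).

CONTENT (theorems only; 0 def, 0 instance, 0 sorry; axioms standard).
* §1 `isHaarMeasure_haar_specialUnitaryGroup`, `windowConst_haar_specialUnitaryGroup_eq` (`σ₀ = 1/∫_{alcove}|det jac| dη`, `s`-free),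
  `fieldMeasure_eq_pi`, `isMulRightInvariant_haar` / `measurePreserving_mul_right_fieldMeasure` (right translations preserve `dU`).
* §2 AT A WINDOW `Θ^B(T)`, `T ⊆ Ω^B`: `lintegral_fieldMeasure_image_eq` (every `F ≥ 0`), `lintegral_fieldMeasure_image_image_eq` (substitution
  inside the product chart, Mathlib cov on `PBond P j → 𝔰𝔲(N)`), `fieldMeasure_restrict_image_prod_eq_smul_map` (the coarse side `dV|_D ⊗ τ` of a
  fibred chart in coordinates), `lintegral_fieldMeasure_image_eq_lintegral_mul_jacobian` (dU to dU, σ₀-free),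
  `fieldMeasure_restrict_image_eq_map_withDensity_jacobian` (the measure form — the «fibred chart» `hmap` shape on `dU`),
  `setIntegral_fieldMeasure_image_eq_integral_jacobian_smul` (Bochner).
* §3 TRANSLATED WINDOWS (any centre `U₀`; right translation preserves `dU`): `fieldMeasure_restrict_translate_image_eq_smul`,
  `lintegral_fieldMeasure_translate_image_eq`, `fieldMeasure_restrict_translate_image_prod_eq_smul_map` (in §2), and
  `lintegral_fieldMeasure_translate_image_eq_lintegral_mul_jacobian` (the `dU`-to-`dU` Jacobian on `Ψ(Θ^B S)·U₀`).

HONEST SCOPE.  Instantiation only: nothing of Bałaban's asserted or estimated; no chart of Bałaban's constructed (`ψ`, `ψ′`, `S`, `Ψ`, `U₀` are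
the consumer's — e.g. the (2.10) linearisation at the record, M3, not here); (F1) at the record, (F3), `hreg`∕`contTOn`∕`regSet`∕`TcanOfRecord`
untouched; nothing of p28 ∕ files 1–3 ∕ `UnitaryModel` ∕ Mathlib re-proved.
-/

noncomputable section

open NormedSpace Set Function Filter Topology MeasureTheory
open scoped ENNReal NNReal Matrix.Norms.L2Operator

namespace Literature.MathematicalPhysics.QuantumFieldTheory.Balaban1983to89.FieldMeasureExpChartChangeOfVariables

open HaarExponentialChart HaarExponentialChart.IsChartRep
open B13HaarSigmaJacobian (jac)

/-! ## §1 The cell's Haar data are Mathlib's Haar measure; `dU` is the product; right translations preserve `dU` -/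

section Instances

variable {N : ℕ} [NeZero N]

/-- `HaarData.haar` on `SU(N)` (the cell's `instHaarDataSpecialUnitaryGroup` = `haarMeasure ⊤`) IS a Haar measure in Mathlib's sense.
[cite: Balaban1985Averaging, (10) p. 19 (bookkeeping)] -/
theorem isHaarMeasure_haar_specialUnitaryGroup :
    (HaarData.haar : Measure (Matrix.specialUnitaryGroup (Fin N) ℂ)).IsHaarMeasure :=
  Measure.isHaarMeasure_haarMeasure _

/-- **THE WINDOW CONSTANT OF `dU(b)` IS `σ₀ = 1 / ∫_{alcove} |det jac| dη`**, the same number for every `0 < s ≤ s_C` (p28 gen 14's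
`windowConst_specialUnitaryGroup_eq` with `μ(SU(N)) = 1` for the cell's probability Haar measure): the powers `σ₀^{|B|}` in the window
identities below are explicit and `s`-independent. [cite: Balaban1985UV3, p. 260] [cite: Balaban1985Averaging, (10) p. 19 (bookkeeping)] -/
theorem windowConst_haar_specialUnitaryGroup_eq [MeasurableSpace (specialUnitaryLogChart (Fin N)).lie]
    [BorelSpace (specialUnitaryLogChart (Fin N)).lie] (η : Measure (specialUnitaryLogChart (Fin N)).lie) [η.IsAddHaarMeasure]
    {s : ℝ} (hs0 : 0 < s) (hs : s ≤ chartRadius (specialUnitaryLogChart (Fin N))) :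
    (HaarData.haar : Measure (Matrix.specialUnitaryGroup (Fin N) ℂ)) ((isChartRep_specialUnitaryGroup (n := Fin N)).window s) /
        (isChartRep_specialUnitaryGroup (n := Fin N)).chartMeasure (lie_adStable_specialUnitaryGroup (n := Fin N)) η s
          ((isChartRep_specialUnitaryGroup (n := Fin N)).window s) =
      1 / ∫⁻ X in SpecialUnitaryAlcove.alcove (Fin N), jacDensity (lie_adStable_specialUnitaryGroup (n := Fin N)) X ∂η := by
  haveI := isHaarMeasure_haar_specialUnitaryGroup (N := N)
  haveI : IsProbabilityMeasure (HaarData.haar : Measure (Matrix.specialUnitaryGroup (Fin N) ℂ)) := HaarData.isProb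
  rw [HaarDensitySpecialUnitaryGlobal.windowConst_specialUnitaryGroup_eq η
    (HaarData.haar : Measure (Matrix.specialUnitaryGroup (Fin N) ℂ)) hs0 hs, measure_univ]

/-- `HaarData.haar` is right invariant (the `HaarData.map_mul_right` field, any gauge group). [cite: Balaban1985Averaging, (10) p. 19 (bookkeeping)] -/
theorem isMulRightInvariant_haar {G : Type*} [GaugeGroup G] [MeasurableSpace G] [HaarData G] :
    (HaarData.haar : Measure G).IsMulRightInvariant :=
  ⟨fun g => HaarData.map_mul_right g⟩

/-- `dU = Π_b dU(b)`: `fieldMeasure P j G = ⊗_{b ∈ PBond P j} HaarData.haar` (`rfl`). [cite: Balaban1985Averaging, (10) p. 19] -/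
theorem fieldMeasure_eq_pi (P : Params) (j : ℕ) (G : Type*) [GaugeGroup G] [MeasurableSpace G] [HaarData G] :
    fieldMeasure P j G = Measure.pi fun _ : PBond P j => (HaarData.haar : Measure G) := rfl

/-- **RIGHT TRANSLATIONS PRESERVE `dU`**: the bond-wise right translation `U ↦ (U(b) · U₀(b))_b` is measure preserving for
`fieldMeasure P j G` (any gauge group with measurable multiplication; `HaarData.map_mul_right` tensored over the bonds).
[cite: Balaban1985Averaging, (10) p. 19] -/
theorem measurePreserving_mul_right_fieldMeasure (P : Params) (j : ℕ) (G : Type*) [GaugeGroup G] [MeasurableSpace G] [HaarData G]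
    [MeasurableMul G] (U₀ : GaugeField P j G) :
    MeasurePreserving (fun (U : GaugeField P j G) (b : PBond P j) => U b * U₀ b) (fieldMeasure P j G) (fieldMeasure P j G) := by
  haveI : (HaarData.haar : Measure G).IsMulRightInvariant := isMulRightInvariant_haar
  haveI : SigmaFinite (HaarData.haar : Measure G) := by
    haveI := HaarData.isProb (G := G); infer_instance
  have h := measurePreserving_mul_right (Measure.pi fun _ : PBond P j => (HaarData.haar : Measure G)) U₀
  exact h

end Instances

/-! ## §2 `dU` on a window `Θ^B(T)` in bond-wise exponential coordinates, and under chart-`C¹` maps -/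

section Window

variable {N : ℕ} [NeZero N] (P : Params) (j : ℕ)
variable [MeasurableSpace (specialUnitaryLogChart (Fin N)).lie] [BorelSpace (specialUnitaryLogChart (Fin N)).lie]
  (η : Measure (specialUnitaryLogChart (Fin N)).lie) [η.IsAddHaarMeasure]

/-- **`dU` ON A WINDOW, EVERY INTEGRAND**: for `0 < s ≤ s_C`, a Borel injectivity domain `Ω ⊆ 𝔰𝔲(N)` of `exp` and a Borel `T ⊆ Ω^B`
(`B = PBond P j`): `∫_{Θ^B T} F dU = σ₀^{|B|} · ∫_T F((e^{A_b})_b) Π_b |det jac(A_b)| d(⊗η)` for every `F : GaugeField → ℝ≥0∞`.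
[cite: Balaban1985Averaging, (10) p. 19] [cite: Balaban1985UV3, (18) p. 260] [cite: Helgason2000, Ch. I §1 Thm. 1.14 (13) p. 96] -/
theorem lintegral_fieldMeasure_image_eq {s : ℝ} (hs0 : 0 < s) (hs : s ≤ chartRadius (specialUnitaryLogChart (Fin N)))
    {Ω : Set (specialUnitaryLogChart (Fin N)).lie} (hΩ : MeasurableSet Ω)
    (hinj : Set.InjOn (isChartRep_specialUnitaryGroup (n := Fin N)).expChart Ω)
    {T : Set (PBond P j → (specialUnitaryLogChart (Fin N)).lie)} (hT : MeasurableSet T) (hTΩ : T ⊆ Set.pi Set.univ fun _ => Ω)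
    (F : GaugeField P j (Matrix.specialUnitaryGroup (Fin N) ℂ) → ℝ≥0∞) :
    ∫⁻ U in (fun A b => (isChartRep_specialUnitaryGroup (n := Fin N)).expChart (A b)) '' T, F U
        ∂(fieldMeasure P j (Matrix.specialUnitaryGroup (Fin N) ℂ)) =
      ((HaarData.haar : Measure (Matrix.specialUnitaryGroup (Fin N) ℂ)) ((isChartRep_specialUnitaryGroup (n := Fin N)).window s) /
          (isChartRep_specialUnitaryGroup (n := Fin N)).chartMeasure (lie_adStable_specialUnitaryGroup (n := Fin N)) η s
            ((isChartRep_specialUnitaryGroup (n := Fin N)).window s)) ^ Fintype.card (PBond P j) *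
        ∫⁻ A in T, F (fun b => (isChartRep_specialUnitaryGroup (n := Fin N)).expChart (A b)) *
          ∏ b, jacDensity (lie_adStable_specialUnitaryGroup (n := Fin N)) (A b) ∂(Measure.pi fun _ : PBond P j => η) := by
  haveI := isHaarMeasure_haar_specialUnitaryGroup (N := N)
  exact (isChartRep_specialUnitaryGroup (n := Fin N)).lintegral_pi_haar_image_eq (lie_adStable_specialUnitaryGroup (n := Fin N))
    η (HaarData.haar : Measure (Matrix.specialUnitaryGroup (Fin N) ℂ)) (PBond P j) hs0 hs hΩ hinj hT hTΩ F

/-- **THE SUBSTITUTION INSIDE THE BOND-WISE CHART, ON `dU`**: for a Borel `S ⊆ 𝔰𝔲(N)^B`, `ψ : 𝔰𝔲(N)^B → 𝔰𝔲(N)^B` injective on `S` with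
derivative `ψ′` within `S` and `ψ(S) ⊆ Ω^B`:
`∫_{Θ^B(ψ S)} F dU = σ₀^{|B|} · ∫_S F((e^{(ψX)_b})_b) · Π_b |det jac((ψX)_b)| · |det ψ′(X)| d(⊗η)` for every `F ≥ 0`
(Mathlib's change of variables on the finite-dimensional space `PBond P j → 𝔰𝔲(N)`, composed).
[cite: Balaban1987RG1, (2.10) p. 267] [cite: Balaban1985UV3, (18) p. 260] [cite: Balaban1985Averaging, (10) p. 19] -/
theorem lintegral_fieldMeasure_image_image_eq {s : ℝ} (hs0 : 0 < s) (hs : s ≤ chartRadius (specialUnitaryLogChart (Fin N)))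
    {Ω : Set (specialUnitaryLogChart (Fin N)).lie} (hΩ : MeasurableSet Ω)
    (hinj : Set.InjOn (isChartRep_specialUnitaryGroup (n := Fin N)).expChart Ω)
    {S : Set (PBond P j → (specialUnitaryLogChart (Fin N)).lie)} (hS : MeasurableSet S)
    {ψ : (PBond P j → (specialUnitaryLogChart (Fin N)).lie) → (PBond P j → (specialUnitaryLogChart (Fin N)).lie)}
    {ψ' : (PBond P j → (specialUnitaryLogChart (Fin N)).lie) →
      (PBond P j → (specialUnitaryLogChart (Fin N)).lie) →L[ℝ] (PBond P j → (specialUnitaryLogChart (Fin N)).lie)}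
    (hψ' : ∀ X ∈ S, HasFDerivWithinAt ψ (ψ' X) S X) (hψ : Set.InjOn ψ S) (hψS : Set.MapsTo ψ S (Set.pi Set.univ fun _ => Ω))
    (F : GaugeField P j (Matrix.specialUnitaryGroup (Fin N) ℂ) → ℝ≥0∞) :
    ∫⁻ U in (fun A b => (isChartRep_specialUnitaryGroup (n := Fin N)).expChart (A b)) '' (ψ '' S), F U
        ∂(fieldMeasure P j (Matrix.specialUnitaryGroup (Fin N) ℂ)) =
      ((HaarData.haar : Measure (Matrix.specialUnitaryGroup (Fin N) ℂ)) ((isChartRep_specialUnitaryGroup (n := Fin N)).window s) /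
          (isChartRep_specialUnitaryGroup (n := Fin N)).chartMeasure (lie_adStable_specialUnitaryGroup (n := Fin N)) η s
            ((isChartRep_specialUnitaryGroup (n := Fin N)).window s)) ^ Fintype.card (PBond P j) *
        ∫⁻ X in S, F (fun b => (isChartRep_specialUnitaryGroup (n := Fin N)).expChart (ψ X b)) *
          (∏ b, jacDensity (lie_adStable_specialUnitaryGroup (n := Fin N)) (ψ X b)) * ENNReal.ofReal |(ψ' X).det|
            ∂(Measure.pi fun _ : PBond P j => η) := by
  haveI := isHaarMeasure_haar_specialUnitaryGroup (N := N)
  exact (isChartRep_specialUnitaryGroup (n := Fin N)).lintegral_pi_haar_image_image_eq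
    (lie_adStable_specialUnitaryGroup (n := Fin N)) η (HaarData.haar : Measure (Matrix.specialUnitaryGroup (Fin N) ℂ)) (PBond P j)
    hs0 hs hΩ hinj hS hψ' hψ hψS F

/-- **THE COARSE SIDE OF A FIBRED CHART ON `dU`**: for every s-finite measure `τ` on a measurable space `Z`, `0 < s ≤ s_C`, a Borel injectivity
domain `Ω` of `exp` and a Borel `T ⊆ Ω^B` (`B = PBond P j`):
`(dU|_{Θ^B T}) ⊗ τ = σ₀^{|B|} • (Θ^B × id)_*(((Π_b |det jac A_b|) · (⊗η)|_T) ⊗ τ)` — the measure `dV|_D ⊗ τ` of a fibred chart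
`dU|_{avg⁻¹ D ∩ S} = Φ_*(J · (dV|_D ⊗ τ))` read in bond-wise exponential coordinates (here `dU`/`dV` is any `fieldMeasure P j SU(N)`).
[cite: Balaban1985Averaging, (10) p. 19] [cite: Balaban1987RG1, (2.10) p. 267] [cite: Balaban1985UV3, (18) p. 260] -/
theorem fieldMeasure_restrict_image_prod_eq_smul_map {s : ℝ} (hs0 : 0 < s) (hs : s ≤ chartRadius (specialUnitaryLogChart (Fin N)))
    {Ω : Set (specialUnitaryLogChart (Fin N)).lie} (hΩ : MeasurableSet Ω)
    (hinj : Set.InjOn (isChartRep_specialUnitaryGroup (n := Fin N)).expChart Ω)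
    {T : Set (PBond P j → (specialUnitaryLogChart (Fin N)).lie)} (hT : MeasurableSet T) (hTΩ : T ⊆ Set.pi Set.univ fun _ => Ω)
    {Z : Type*} [MeasurableSpace Z] (τ : Measure Z) [SFinite τ] :
    ((fieldMeasure P j (Matrix.specialUnitaryGroup (Fin N) ℂ)).restrict
        ((fun A b => (isChartRep_specialUnitaryGroup (n := Fin N)).expChart (A b)) '' T)).prod τ =
      ((HaarData.haar : Measure (Matrix.specialUnitaryGroup (Fin N) ℂ)) ((isChartRep_specialUnitaryGroup (n := Fin N)).window s) /
          (isChartRep_specialUnitaryGroup (n := Fin N)).chartMeasure (lie_adStable_specialUnitaryGroup (n := Fin N)) η s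
            ((isChartRep_specialUnitaryGroup (n := Fin N)).window s)) ^ Fintype.card (PBond P j) •
        ((((Measure.pi fun _ : PBond P j => η).restrict T).withDensity
            (fun A => ∏ b, jacDensity (lie_adStable_specialUnitaryGroup (n := Fin N)) (A b))).prod τ).map
          (Prod.map (fun A b => (isChartRep_specialUnitaryGroup (n := Fin N)).expChart (A b)) id) := by
  haveI := isHaarMeasure_haar_specialUnitaryGroup (N := N)
  exact (isChartRep_specialUnitaryGroup (n := Fin N)).pi_haar_restrict_image_prod_eq_smul_map
    (lie_adStable_specialUnitaryGroup (n := Fin N)) η (HaarData.haar : Measure (Matrix.specialUnitaryGroup (Fin N) ℂ)) (PBond P j)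
    hs0 hs hΩ hinj hT hTΩ τ

/-- **`dU` ON A TRANSLATED WINDOW (measure form)**: for every configuration `U₀`, `0 < s ≤ s_C`, a Borel injectivity domain `Ω` of `exp`
and a Borel `T ⊆ Ω^B`: `dU|_{Θ^B(T)·U₀} = σ₀^{|B|} • (A ↦ Θ^B(A)·U₀)_*((Π_b |det jac A_b|) · (⊗η)|_T)` — the bond-wise exponential
chart CENTRED AT `U₀` (right translations preserve `dU`). [cite: Balaban1985Averaging, (10) p. 19] [cite: Balaban1985UV3, (18) p. 260]
[cite: Helgason2000, Ch. I §1 Thm. 1.14 (13) p. 96] -/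
theorem fieldMeasure_restrict_translate_image_eq_smul {s : ℝ} (hs0 : 0 < s) (hs : s ≤ chartRadius (specialUnitaryLogChart (Fin N)))
    {Ω : Set (specialUnitaryLogChart (Fin N)).lie} (hΩ : MeasurableSet Ω)
    (hinj : Set.InjOn (isChartRep_specialUnitaryGroup (n := Fin N)).expChart Ω)
    {T : Set (PBond P j → (specialUnitaryLogChart (Fin N)).lie)} (hT : MeasurableSet T) (hTΩ : T ⊆ Set.pi Set.univ fun _ => Ω)
    (U₀ : GaugeField P j (Matrix.specialUnitaryGroup (Fin N) ℂ)) :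
    (fieldMeasure P j (Matrix.specialUnitaryGroup (Fin N) ℂ)).restrict
        ((fun (U : GaugeField P j (Matrix.specialUnitaryGroup (Fin N) ℂ)) (b : PBond P j) => U b * U₀ b) ''
          ((fun A b => (isChartRep_specialUnitaryGroup (n := Fin N)).expChart (A b)) '' T)) =
      ((HaarData.haar : Measure (Matrix.specialUnitaryGroup (Fin N) ℂ)) ((isChartRep_specialUnitaryGroup (n := Fin N)).window s) /
          (isChartRep_specialUnitaryGroup (n := Fin N)).chartMeasure (lie_adStable_specialUnitaryGroup (n := Fin N)) η s
            ((isChartRep_specialUnitaryGroup (n := Fin N)).window s)) ^ Fintype.card (PBond P j) •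
        (((Measure.pi fun _ : PBond P j => η).restrict T).withDensity
            (fun A => ∏ b, jacDensity (lie_adStable_specialUnitaryGroup (n := Fin N)) (A b))).map
          (fun A b => (isChartRep_specialUnitaryGroup (n := Fin N)).expChart (A b) * U₀ b) := by
  haveI := isHaarMeasure_haar_specialUnitaryGroup (N := N)
  haveI : (HaarData.haar : Measure (Matrix.specialUnitaryGroup (Fin N) ℂ)).IsMulRightInvariant := isMulRightInvariant_haar
  exact (isChartRep_specialUnitaryGroup (n := Fin N)).pi_haar_restrict_translate_image_eq_smul
    (lie_adStable_specialUnitaryGroup (n := Fin N)) η (HaarData.haar : Measure (Matrix.specialUnitaryGroup (Fin N) ℂ)) (PBond P j)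
    hs0 hs hΩ hinj hT hTΩ U₀

/-- **`dU` ON A TRANSLATED WINDOW, EVERY INTEGRAND**: `∫_{Θ^B(T)·U₀} F dU = σ₀^{|B|} · ∫_T F((e^{A_b})_b · U₀) Π_b |det jac(A_b)| d(⊗η)`.
[cite: Balaban1985Averaging, (10) p. 19] [cite: Balaban1985UV3, (18) p. 260] [cite: Helgason2000, Ch. I §1 Thm. 1.14 (13) p. 96] -/
theorem lintegral_fieldMeasure_translate_image_eq {s : ℝ} (hs0 : 0 < s) (hs : s ≤ chartRadius (specialUnitaryLogChart (Fin N)))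
    {Ω : Set (specialUnitaryLogChart (Fin N)).lie} (hΩ : MeasurableSet Ω)
    (hinj : Set.InjOn (isChartRep_specialUnitaryGroup (n := Fin N)).expChart Ω)
    {T : Set (PBond P j → (specialUnitaryLogChart (Fin N)).lie)} (hT : MeasurableSet T) (hTΩ : T ⊆ Set.pi Set.univ fun _ => Ω)
    (U₀ : GaugeField P j (Matrix.specialUnitaryGroup (Fin N) ℂ))
    (F : GaugeField P j (Matrix.specialUnitaryGroup (Fin N) ℂ) → ℝ≥0∞) :
    ∫⁻ U in (fun (U : GaugeField P j (Matrix.specialUnitaryGroup (Fin N) ℂ)) (b : PBond P j) => U b * U₀ b) ''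
        ((fun A b => (isChartRep_specialUnitaryGroup (n := Fin N)).expChart (A b)) '' T), F U
        ∂(fieldMeasure P j (Matrix.specialUnitaryGroup (Fin N) ℂ)) =
      ((HaarData.haar : Measure (Matrix.specialUnitaryGroup (Fin N) ℂ)) ((isChartRep_specialUnitaryGroup (n := Fin N)).window s) /
          (isChartRep_specialUnitaryGroup (n := Fin N)).chartMeasure (lie_adStable_specialUnitaryGroup (n := Fin N)) η s
            ((isChartRep_specialUnitaryGroup (n := Fin N)).window s)) ^ Fintype.card (PBond P j) *
        ∫⁻ A in T, F (fun b => (isChartRep_specialUnitaryGroup (n := Fin N)).expChart (A b) * U₀ b) *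
          ∏ b, jacDensity (lie_adStable_specialUnitaryGroup (n := Fin N)) (A b) ∂(Measure.pi fun _ : PBond P j => η) := by
  haveI := isHaarMeasure_haar_specialUnitaryGroup (N := N)
  haveI : (HaarData.haar : Measure (Matrix.specialUnitaryGroup (Fin N) ℂ)).IsMulRightInvariant := isMulRightInvariant_haar
  exact (isChartRep_specialUnitaryGroup (n := Fin N)).lintegral_pi_haar_translate_image_eq
    (lie_adStable_specialUnitaryGroup (n := Fin N)) η (HaarData.haar : Measure (Matrix.specialUnitaryGroup (Fin N) ℂ)) (PBond P j)
    hs0 hs hΩ hinj hT hTΩ U₀ F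

/-- **THE COARSE SIDE OF A FIBRED CHART ON `dV` AT A TRANSLATED WINDOW**: for every configuration `V₀` and s-finite `τ`,
`(dV|_{Θ^B(T)·V₀}) ⊗ τ = σ₀^{|B|} • ((A ↦ Θ^B(A)·V₀) × id)_*(((Π_b |det jac A_b|) · (⊗η)|_T) ⊗ τ)`.
[cite: Balaban1985Averaging, (10) p. 19] [cite: Balaban1987RG1, (2.10) p. 267] [cite: Balaban1985UV3, (18) p. 260] -/
theorem fieldMeasure_restrict_translate_image_prod_eq_smul_map {s : ℝ} (hs0 : 0 < s)
    (hs : s ≤ chartRadius (specialUnitaryLogChart (Fin N)))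
    {Ω : Set (specialUnitaryLogChart (Fin N)).lie} (hΩ : MeasurableSet Ω)
    (hinj : Set.InjOn (isChartRep_specialUnitaryGroup (n := Fin N)).expChart Ω)
    {T : Set (PBond P j → (specialUnitaryLogChart (Fin N)).lie)} (hT : MeasurableSet T) (hTΩ : T ⊆ Set.pi Set.univ fun _ => Ω)
    (V₀ : GaugeField P j (Matrix.specialUnitaryGroup (Fin N) ℂ)) {Z : Type*} [MeasurableSpace Z] (τ : Measure Z) [SFinite τ] :
    ((fieldMeasure P j (Matrix.specialUnitaryGroup (Fin N) ℂ)).restrict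
        ((fun (U : GaugeField P j (Matrix.specialUnitaryGroup (Fin N) ℂ)) (b : PBond P j) => U b * V₀ b) ''
          ((fun A b => (isChartRep_specialUnitaryGroup (n := Fin N)).expChart (A b)) '' T))).prod τ =
      ((HaarData.haar : Measure (Matrix.specialUnitaryGroup (Fin N) ℂ)) ((isChartRep_specialUnitaryGroup (n := Fin N)).window s) /
          (isChartRep_specialUnitaryGroup (n := Fin N)).chartMeasure (lie_adStable_specialUnitaryGroup (n := Fin N)) η s
            ((isChartRep_specialUnitaryGroup (n := Fin N)).window s)) ^ Fintype.card (PBond P j) •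
        ((((Measure.pi fun _ : PBond P j => η).restrict T).withDensity
            (fun A => ∏ b, jacDensity (lie_adStable_specialUnitaryGroup (n := Fin N)) (A b))).prod τ).map
          (Prod.map (fun A b => (isChartRep_specialUnitaryGroup (n := Fin N)).expChart (A b) * V₀ b) id) := by
  haveI := isHaarMeasure_haar_specialUnitaryGroup (N := N)
  haveI : (HaarData.haar : Measure (Matrix.specialUnitaryGroup (Fin N) ℂ)).IsMulRightInvariant := isMulRightInvariant_haar
  exact (isChartRep_specialUnitaryGroup (n := Fin N)).pi_haar_restrict_translate_image_prod_eq_smul_map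
    (lie_adStable_specialUnitaryGroup (n := Fin N)) η (HaarData.haar : Measure (Matrix.specialUnitaryGroup (Fin N) ℂ)) (PBond P j)
    hs0 hs hΩ hinj hT hTΩ V₀ τ

/-! ## §2′ `dU` to `dU`: the Jacobian of a chart-`C¹` map of gauge fields, `σ₀`-free -/

/-- **`dU` TO `dU` WITH THE JACOBIAN WRITTEN OUT**: for `0 < s ≤ s_C`, a Borel `S ⊆ B(0,s)^B ⊆ 𝔰𝔲(N)^B` on which `det jac(X_b) ≠ 0`, `ψ` injective
and differentiable within `S` with `ψ(S) ⊆ B(0,s)^B`, and `Ψ : GaugeField → GaugeField` with `Ψ(Θ^B X) = Θ^B(ψ X)` on `S`: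
`∫_{Ψ(Θ^B S)} F dU = ∫_{Θ^B S} F(Ψ U) · J_Ψ(U) dU`, `J_Ψ(U) = (Π_b |det jac((ψ(Λ^B U))_b)|) · |det ψ′(Λ^B U)| / Π_b |det jac(log U_b)|`, every `F ≥ 0`.
[cite: Balaban1987RG1, (2.10) p. 267] [cite: Balaban1985Averaging, (10) p. 19] [cite: Helgason2000, Ch. I §1 Thm. 1.14 (13) p. 96] -/
theorem lintegral_fieldMeasure_image_eq_lintegral_mul_jacobian {s : ℝ} (hs0 : 0 < s)
    (hs : s ≤ chartRadius (specialUnitaryLogChart (Fin N)))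
    {S : Set (PBond P j → (specialUnitaryLogChart (Fin N)).lie)} (hS : MeasurableSet S)
    (hSs : S ⊆ Set.pi Set.univ fun _ => Metric.ball (0 : (specialUnitaryLogChart (Fin N)).lie) s)
    (hjac : ∀ X ∈ S, ∀ b, LinearMap.det (jac (lie_adStable_specialUnitaryGroup (n := Fin N)) (X b) :
      (specialUnitaryLogChart (Fin N)).lie →ₗ[ℝ] (specialUnitaryLogChart (Fin N)).lie) ≠ 0)
    {ψ : (PBond P j → (specialUnitaryLogChart (Fin N)).lie) → (PBond P j → (specialUnitaryLogChart (Fin N)).lie)}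
    {ψ' : (PBond P j → (specialUnitaryLogChart (Fin N)).lie) →
      (PBond P j → (specialUnitaryLogChart (Fin N)).lie) →L[ℝ] (PBond P j → (specialUnitaryLogChart (Fin N)).lie)}
    (hψ' : ∀ X ∈ S, HasFDerivWithinAt ψ (ψ' X) S X) (hψ : Set.InjOn ψ S)
    (hψS : Set.MapsTo ψ S (Set.pi Set.univ fun _ => Metric.ball (0 : (specialUnitaryLogChart (Fin N)).lie) s))
    {Ψ : GaugeField P j (Matrix.specialUnitaryGroup (Fin N) ℂ) → GaugeField P j (Matrix.specialUnitaryGroup (Fin N) ℂ)}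
    (hΨ : ∀ X ∈ S, Ψ (fun b => (isChartRep_specialUnitaryGroup (n := Fin N)).expChart (X b)) =
      fun b => (isChartRep_specialUnitaryGroup (n := Fin N)).expChart (ψ X b))
    (F : GaugeField P j (Matrix.specialUnitaryGroup (Fin N) ℂ) → ℝ≥0∞) :
    ∫⁻ U in Ψ '' ((fun A b => (isChartRep_specialUnitaryGroup (n := Fin N)).expChart (A b)) '' S), F U
        ∂(fieldMeasure P j (Matrix.specialUnitaryGroup (Fin N) ℂ)) =
      ∫⁻ U in (fun A b => (isChartRep_specialUnitaryGroup (n := Fin N)).expChart (A b)) '' S, F (Ψ U) *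
        ((∏ b, jacDensity (lie_adStable_specialUnitaryGroup (n := Fin N))
              (ψ (fun b => (isChartRep_specialUnitaryGroup (n := Fin N)).logChart (U b)) b)) *
            ENNReal.ofReal |(ψ' fun b => (isChartRep_specialUnitaryGroup (n := Fin N)).logChart (U b)).det| /
          ∏ b, jacDensity (lie_adStable_specialUnitaryGroup (n := Fin N)) ((isChartRep_specialUnitaryGroup (n := Fin N)).logChart (U b)))
        ∂(fieldMeasure P j (Matrix.specialUnitaryGroup (Fin N) ℂ)) := by
  haveI := isHaarMeasure_haar_specialUnitaryGroup (N := N)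
  exact (isChartRep_specialUnitaryGroup (n := Fin N)).lintegral_pi_haar_image_eq_lintegral_mul_jacobian
    (lie_adStable_specialUnitaryGroup (n := Fin N)) (HaarData.haar : Measure (Matrix.specialUnitaryGroup (Fin N) ℂ)) (PBond P j)
    hs0 hs hS hSs hjac hψ' hψ hψS hΨ F

/-- **THE MEASURE FORM ON `dU` (the «fibred chart» `hmap` shape)**: under the same hypotheses,
`dU|_{Ψ(Θ^B S)} = Ψ_*(J_Ψ · dU|_{Θ^B S})`. [cite: Balaban1987RG1, (2.10) p. 267] [cite: Balaban1985Averaging, (10) p. 19]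
[cite: Helgason2000, Ch. I §1 Thm. 1.14 (13) p. 96] -/
theorem fieldMeasure_restrict_image_eq_map_withDensity_jacobian {s : ℝ} (hs0 : 0 < s)
    (hs : s ≤ chartRadius (specialUnitaryLogChart (Fin N)))
    {S : Set (PBond P j → (specialUnitaryLogChart (Fin N)).lie)} (hS : MeasurableSet S)
    (hSs : S ⊆ Set.pi Set.univ fun _ => Metric.ball (0 : (specialUnitaryLogChart (Fin N)).lie) s)
    (hjac : ∀ X ∈ S, ∀ b, LinearMap.det (jac (lie_adStable_specialUnitaryGroup (n := Fin N)) (X b) :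
      (specialUnitaryLogChart (Fin N)).lie →ₗ[ℝ] (specialUnitaryLogChart (Fin N)).lie) ≠ 0)
    {ψ : (PBond P j → (specialUnitaryLogChart (Fin N)).lie) → (PBond P j → (specialUnitaryLogChart (Fin N)).lie)}
    {ψ' : (PBond P j → (specialUnitaryLogChart (Fin N)).lie) →
      (PBond P j → (specialUnitaryLogChart (Fin N)).lie) →L[ℝ] (PBond P j → (specialUnitaryLogChart (Fin N)).lie)}
    (hψ' : ∀ X ∈ S, HasFDerivWithinAt ψ (ψ' X) S X) (hψ : Set.InjOn ψ S)
    (hψS : Set.MapsTo ψ S (Set.pi Set.univ fun _ => Metric.ball (0 : (specialUnitaryLogChart (Fin N)).lie) s))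
    {Ψ : GaugeField P j (Matrix.specialUnitaryGroup (Fin N) ℂ) → GaugeField P j (Matrix.specialUnitaryGroup (Fin N) ℂ)}
    (hΨ : ∀ X ∈ S, Ψ (fun b => (isChartRep_specialUnitaryGroup (n := Fin N)).expChart (X b)) =
      fun b => (isChartRep_specialUnitaryGroup (n := Fin N)).expChart (ψ X b)) :
    (fieldMeasure P j (Matrix.specialUnitaryGroup (Fin N) ℂ)).restrict
        (Ψ '' ((fun A b => (isChartRep_specialUnitaryGroup (n := Fin N)).expChart (A b)) '' S)) =
      Measure.map Ψ (((fieldMeasure P j (Matrix.specialUnitaryGroup (Fin N) ℂ)).restrict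
          ((fun A b => (isChartRep_specialUnitaryGroup (n := Fin N)).expChart (A b)) '' S)).withDensity fun U =>
        (∏ b, jacDensity (lie_adStable_specialUnitaryGroup (n := Fin N))
              (ψ (fun b => (isChartRep_specialUnitaryGroup (n := Fin N)).logChart (U b)) b)) *
            ENNReal.ofReal |(ψ' fun b => (isChartRep_specialUnitaryGroup (n := Fin N)).logChart (U b)).det| /
          ∏ b, jacDensity (lie_adStable_specialUnitaryGroup (n := Fin N)) ((isChartRep_specialUnitaryGroup (n := Fin N)).logChart (U b))) := by
  haveI := isHaarMeasure_haar_specialUnitaryGroup (N := N)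
  exact (isChartRep_specialUnitaryGroup (n := Fin N)).pi_haar_restrict_image_eq_map_withDensity_jacobian
    (lie_adStable_specialUnitaryGroup (n := Fin N)) (HaarData.haar : Measure (Matrix.specialUnitaryGroup (Fin N) ℂ)) (PBond P j)
    hs0 hs hS hSs hjac hψ' hψ hψS hΨ

variable {E : Type*} [NormedAddCommGroup E] [NormedSpace ℝ E]

/-- **THE BOCHNER FORM ON `dU`**: under the same hypotheses, for every `F : GaugeField → E` a.e.-strongly measurable on `Ψ(Θ^B S)`:
`∫_{Ψ(Θ^B S)} F dU = ∫_{Θ^B S} (J_Ψ U).toReal • F(Ψ U) dU`. [cite: Balaban1987RG1, (2.10) p. 267] [cite: Balaban1985Averaging, (10) p. 19]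
[cite: Helgason2000, Ch. I §1 Thm. 1.14 (13) p. 96] -/
theorem setIntegral_fieldMeasure_image_eq_integral_jacobian_smul {s : ℝ} (hs0 : 0 < s)
    (hs : s ≤ chartRadius (specialUnitaryLogChart (Fin N)))
    {S : Set (PBond P j → (specialUnitaryLogChart (Fin N)).lie)} (hS : MeasurableSet S)
    (hSs : S ⊆ Set.pi Set.univ fun _ => Metric.ball (0 : (specialUnitaryLogChart (Fin N)).lie) s)
    (hjac : ∀ X ∈ S, ∀ b, LinearMap.det (jac (lie_adStable_specialUnitaryGroup (n := Fin N)) (X b) :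
      (specialUnitaryLogChart (Fin N)).lie →ₗ[ℝ] (specialUnitaryLogChart (Fin N)).lie) ≠ 0)
    {ψ : (PBond P j → (specialUnitaryLogChart (Fin N)).lie) → (PBond P j → (specialUnitaryLogChart (Fin N)).lie)}
    {ψ' : (PBond P j → (specialUnitaryLogChart (Fin N)).lie) →
      (PBond P j → (specialUnitaryLogChart (Fin N)).lie) →L[ℝ] (PBond P j → (specialUnitaryLogChart (Fin N)).lie)}
    (hψ' : ∀ X ∈ S, HasFDerivWithinAt ψ (ψ' X) S X) (hψ : Set.InjOn ψ S)
    (hψS : Set.MapsTo ψ S (Set.pi Set.univ fun _ => Metric.ball (0 : (specialUnitaryLogChart (Fin N)).lie) s))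
    {Ψ : GaugeField P j (Matrix.specialUnitaryGroup (Fin N) ℂ) → GaugeField P j (Matrix.specialUnitaryGroup (Fin N) ℂ)}
    (hΨ : ∀ X ∈ S, Ψ (fun b => (isChartRep_specialUnitaryGroup (n := Fin N)).expChart (X b)) =
      fun b => (isChartRep_specialUnitaryGroup (n := Fin N)).expChart (ψ X b))
    {F : GaugeField P j (Matrix.specialUnitaryGroup (Fin N) ℂ) → E}
    (hF : AEStronglyMeasurable F ((fieldMeasure P j (Matrix.specialUnitaryGroup (Fin N) ℂ)).restrict
      (Ψ '' ((fun A b => (isChartRep_specialUnitaryGroup (n := Fin N)).expChart (A b)) '' S)))) :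
    ∫ U in Ψ '' ((fun A b => (isChartRep_specialUnitaryGroup (n := Fin N)).expChart (A b)) '' S), F U
        ∂(fieldMeasure P j (Matrix.specialUnitaryGroup (Fin N) ℂ)) =
      ∫ U in (fun A b => (isChartRep_specialUnitaryGroup (n := Fin N)).expChart (A b)) '' S,
        ((∏ b, jacDensity (lie_adStable_specialUnitaryGroup (n := Fin N))
              (ψ (fun b => (isChartRep_specialUnitaryGroup (n := Fin N)).logChart (U b)) b)) *
            ENNReal.ofReal |(ψ' fun b => (isChartRep_specialUnitaryGroup (n := Fin N)).logChart (U b)).det| /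
          ∏ b, jacDensity (lie_adStable_specialUnitaryGroup (n := Fin N))
            ((isChartRep_specialUnitaryGroup (n := Fin N)).logChart (U b))).toReal • F (Ψ U)
        ∂(fieldMeasure P j (Matrix.specialUnitaryGroup (Fin N) ℂ)) := by
  haveI := isHaarMeasure_haar_specialUnitaryGroup (N := N)
  exact (isChartRep_specialUnitaryGroup (n := Fin N)).setIntegral_pi_haar_image_eq_integral_jacobian_smul
    (lie_adStable_specialUnitaryGroup (n := Fin N)) (HaarData.haar : Measure (Matrix.specialUnitaryGroup (Fin N) ℂ)) (PBond P j)
    hs0 hs hS hSs hjac hψ' hψ hψS hΨ hF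

/-! ## §3 Translated windows `Ψ(Θ^B S) · U₀` around an arbitrary configuration `U₀` -/

/-- **`dU` TO `dU` ON A TRANSLATED WINDOW**: under the hypotheses of `lintegral_fieldMeasure_image_eq_lintegral_mul_jacobian` and for
every configuration `U₀`, `∫_{Ψ(Θ^B S)·U₀} F dU = ∫_{Θ^B S} F(Ψ(U)·U₀) · J_Ψ(U) dU` for every `F ≥ 0` (bond-wise right translation by `U₀`
preserves `dU`: `measurePreserving_mul_right_fieldMeasure`) — the chart may be centred at any gauge field, e.g. a background
configuration. [cite: Balaban1987RG1, (2.10) p. 267] [cite: Balaban1985Averaging, (10) p. 19] [cite: Helgason2000, Ch. I §1 Thm. 1.14 (13) p. 96] -/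
theorem lintegral_fieldMeasure_translate_image_eq_lintegral_mul_jacobian {s : ℝ} (hs0 : 0 < s)
    (hs : s ≤ chartRadius (specialUnitaryLogChart (Fin N)))
    {S : Set (PBond P j → (specialUnitaryLogChart (Fin N)).lie)} (hS : MeasurableSet S)
    (hSs : S ⊆ Set.pi Set.univ fun _ => Metric.ball (0 : (specialUnitaryLogChart (Fin N)).lie) s)
    (hjac : ∀ X ∈ S, ∀ b, LinearMap.det (jac (lie_adStable_specialUnitaryGroup (n := Fin N)) (X b) :
      (specialUnitaryLogChart (Fin N)).lie →ₗ[ℝ] (specialUnitaryLogChart (Fin N)).lie) ≠ 0)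
    {ψ : (PBond P j → (specialUnitaryLogChart (Fin N)).lie) → (PBond P j → (specialUnitaryLogChart (Fin N)).lie)}
    {ψ' : (PBond P j → (specialUnitaryLogChart (Fin N)).lie) →
      (PBond P j → (specialUnitaryLogChart (Fin N)).lie) →L[ℝ] (PBond P j → (specialUnitaryLogChart (Fin N)).lie)}
    (hψ' : ∀ X ∈ S, HasFDerivWithinAt ψ (ψ' X) S X) (hψ : Set.InjOn ψ S)
    (hψS : Set.MapsTo ψ S (Set.pi Set.univ fun _ => Metric.ball (0 : (specialUnitaryLogChart (Fin N)).lie) s))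
    {Ψ : GaugeField P j (Matrix.specialUnitaryGroup (Fin N) ℂ) → GaugeField P j (Matrix.specialUnitaryGroup (Fin N) ℂ)}
    (hΨ : ∀ X ∈ S, Ψ (fun b => (isChartRep_specialUnitaryGroup (n := Fin N)).expChart (X b)) =
      fun b => (isChartRep_specialUnitaryGroup (n := Fin N)).expChart (ψ X b))
    (U₀ : GaugeField P j (Matrix.specialUnitaryGroup (Fin N) ℂ))
    (F : GaugeField P j (Matrix.specialUnitaryGroup (Fin N) ℂ) → ℝ≥0∞) :
    ∫⁻ U in (fun (U : GaugeField P j (Matrix.specialUnitaryGroup (Fin N) ℂ)) (b : PBond P j) => U b * U₀ b) ''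
        (Ψ '' ((fun A b => (isChartRep_specialUnitaryGroup (n := Fin N)).expChart (A b)) '' S)), F U
        ∂(fieldMeasure P j (Matrix.specialUnitaryGroup (Fin N) ℂ)) =
      ∫⁻ U in (fun A b => (isChartRep_specialUnitaryGroup (n := Fin N)).expChart (A b)) '' S, F (fun b => Ψ U b * U₀ b) *
        ((∏ b, jacDensity (lie_adStable_specialUnitaryGroup (n := Fin N))
              (ψ (fun b => (isChartRep_specialUnitaryGroup (n := Fin N)).logChart (U b)) b)) *
            ENNReal.ofReal |(ψ' fun b => (isChartRep_specialUnitaryGroup (n := Fin N)).logChart (U b)).det| /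
          ∏ b, jacDensity (lie_adStable_specialUnitaryGroup (n := Fin N)) ((isChartRep_specialUnitaryGroup (n := Fin N)).logChart (U b)))
        ∂(fieldMeasure P j (Matrix.specialUnitaryGroup (Fin N) ℂ)) := by
  have hmp := measurePreserving_mul_right_fieldMeasure P j (Matrix.specialUnitaryGroup (Fin N) ℂ) U₀
  have hemb : MeasurableEmbedding (fun (U : GaugeField P j (Matrix.specialUnitaryGroup (Fin N) ℂ)) (b : PBond P j) => U b * U₀ b) :=
    (MeasurableEquiv.mulRight (show (PBond P j → Matrix.specialUnitaryGroup (Fin N) ℂ) from U₀)).measurableEmbedding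
  have h1 := hmp.setLIntegral_comp_emb hemb F
    (Ψ '' ((fun A b => (isChartRep_specialUnitaryGroup (n := Fin N)).expChart (A b)) '' S))
  refine h1.symm.trans ?_
  exact lintegral_fieldMeasure_image_eq_lintegral_mul_jacobian P j hs0 hs hS hSs hjac hψ' hψ hψS hΨ (fun U => F fun b => U b * U₀ b)

end Window

end Literature.MathematicalPhysics.QuantumFieldTheory.Balaban1983to89.FieldMeasureExpChartChangeOfVariables
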